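import Summits.ABC.StewartYu.PadicShapeDepElimOdd
import HarnessLib

/-!
# Cell abc-stewartyu — draft route `YuMatveevShapeRat` (plan-m3 g2): the `p`-adic SHAPE bound for
# `ord_p(1 − ζ∏ξᵢ^{bᵢ})`, odd `p` (non-units and torsion), proved from the dependence-free core

Cell `abc-stewartyu` (HOME `run/shared/lean/pub/abc-stewartyu/`; seat `lit-abc-yu2007` g3). Theorems only;
no definition, no named fact, nothing closed. Third `p`-adic ingredient of the draft item `PadicShapeChain`
(after `PadicShapeDepElimOdd.lean`): from the shape bound for ARBITRARY rational `p`-adic units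
(`∏ θᵢ^{mᵢ} ≠ 1`; the conclusion of `padicShape_dep_of_indep_odd`) to the bound
`ord_p(1 − Ξ) log p ≤ c'ʳ (p/log p) ∏Aᵢ (W + log p + log 2A_max)` for `Ξ = ζ∏ξᵢ^{bᵢ} ≠ 1`, `ζ = ±1`,
NON-ZERO rationals `ξᵢ` (not necessarily units), `h(ξᵢ) ≤ Aᵢ`, `1 ≤ Aᵢ ≤ A_max`, `log max(3,|bᵢ|) ≤ W`,
`1 ≤ W` (`padicShape_oneSub_of_dep_odd`, `c' = 2|c| + 2`), and the composite from the planner's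
`PadicCoreOddRat` text (`padicShape_oneSub_of_indep_odd`). This is the input of Evertse–Győry's §4.4.2 at a
finite place with `α = 1` BEFORE the choice of small exponents (`exists_small_exponents`) and the Case A/B
comparison of `W` with `log h(Ξ)` — those steps, K-parametric, remain. Argument (the opening reductions of
`Literature.Barriers.ABC.yu2007_padicLogForm_rat_of_core` / `_of_core'` in shape currency): if
`ord_p(1 − Ξ) ≤ 0` the bound is trivial; otherwise `ord_p Ξ = 0`, the `p`-free parts `uᵢ = ξᵢ p^{−ord_p ξᵢ}`
are units with `h(uᵢ) ≤ h(ξᵢ)` (`logHeight₁_div_zpow_padicValRat_le`) and `∏ξᵢ^{bᵢ} = ∏uᵢ^{bᵢ}`; for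
`ζ = 1` apply the core; for `ζ = −1`, `ord_p(1 + Ξ') ≤ ord_p(Ξ'² − 1)` (`padicValRat_add_one_le_sq_sub_one`)
and the core with the doubled exponents `2bᵢ` (`W + log 2 ≤ 2W`). WHAT THIS IS NOT: no analytic estimate;
no crux moved; no abc claim. References: [EvertseGyory2015] §4.4 (pp. 80–81); [Yu1999] §1 (p. 339), §14.
-/

open Height Real Finset
open Literature.NumberTheory.DiophantineGeometry.Dioph
open Literature.Barriers.ABC

noncomputable section

namespace Summit.ABC.StewartYu

/-- **`ord_p(1 − ζ∏ξᵢ^{bᵢ}) log p ≤ c'ʳ (p/log p) ∏Aᵢ (W + log p + log 2A_max)` from the dependence-free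
`p`-adic shape bound, odd `p`.** The hypothesis is the conclusion of `padicShape_dep_of_indep_odd`
(rational `p`-adic units, `∏θᵢ^{mᵢ} ≠ 1`); the conclusion is the same currency for `Ξ = ζ∏ξᵢ^{bᵢ} ≠ 1`
with non-zero rationals `ξᵢ`, `ζ = ±1`, `1 ≤ A_max`; `c' = 2|c| + 2`.
[cite: EvertseGyory2015, §4.4 (pp. 80–81)] [cite: Yu1999, §14 (p. 377)] -/
theorem padicShape_oneSub_of_dep_odd
    (h : ∃ c : ℝ, ∀ (p : ℕ), p.Prime → p ≠ 2 →
      ∀ (r : ℕ) (θ : Fin r → ℚ) (m : Fin r → ℤ) (A : Fin r → ℝ) (Amax W : ℝ),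
        (∀ i, θ i ≠ 0 ∧ padicValRat p (θ i) = 0) →
        (∀ i, Height.logHeight₁ (θ i) ≤ A i) → (∀ i, 1 ≤ A i) → (∀ i, A i ≤ Amax) →
        (∀ i, Real.log (max 3 (|m i| : ℝ)) ≤ W) → 1 ≤ W → ∏ i, θ i ^ m i ≠ 1 →
        (padicValRat p (∏ i, θ i ^ m i - 1) : ℝ) * Real.log p ≤
          c ^ r * ((p : ℝ) / Real.log p) * (∏ i, A i) * (W + Real.log p + Real.log (2 * Amax))) :
    ∃ c : ℝ, ∀ (p : ℕ), p.Prime → p ≠ 2 →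
      ∀ (r : ℕ) (ξ : Fin r → ℚ) (b : Fin r → ℤ) (A : Fin r → ℝ) (Amax W : ℝ) (ζ : ℚ),
        (ζ = 1 ∨ ζ = -1) → (∀ i, ξ i ≠ 0) →
        (∀ i, Height.logHeight₁ (ξ i) ≤ A i) → (∀ i, 1 ≤ A i) → (∀ i, A i ≤ Amax) → 1 ≤ Amax →
        (∀ i, Real.log (max 3 (|b i| : ℝ)) ≤ W) → 1 ≤ W → ζ * ∏ i, ξ i ^ b i ≠ 1 →
        (padicValRat p (1 - ζ * ∏ i, ξ i ^ b i) : ℝ) * Real.log p ≤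
          c ^ r * ((p : ℝ) / Real.log p) * (∏ i, A i) * (W + Real.log p + Real.log (2 * Amax)) := by
  obtain ⟨c, hc⟩ := h
  refine ⟨2 * |c| + 2, fun p hp hp2 r ξ b A Amax W ζ hζ hξ hAh hA1 hAm hAmax hbW hW1 hΞ1 => ?_⟩
  haveI : Fact p.Prime := ⟨hp⟩
  haveI : Fact (Nat.Prime 2) := ⟨Nat.prime_two⟩
  have hp1 : (1 : ℝ) < p := by exact_mod_cast hp.one_lt
  have hlogp : 0 < Real.log p := Real.log_pos hp1
  have hq0 : 0 < (p : ℝ) / Real.log p := div_pos (by linarith) hlogp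
  have hA0 : ∀ i, 0 < A i := fun i => lt_of_lt_of_le one_pos (hA1 i)
  have hP0 : 0 < ∏ i, A i := Finset.prod_pos fun i _ => hA0 i
  have hL2A : 0 ≤ Real.log (2 * Amax) := Real.log_nonneg (by linarith)
  set G := W + Real.log p + Real.log (2 * Amax) with hG
  have hGW : W ≤ G := by rw [hG]; linarith
  have hG1 : 1 ≤ G := le_trans hW1 hGW
  have hc2 : (2 : ℝ) ≤ 2 * |c| + 2 := by linarith [abs_nonneg c]
  have hRHS0 : 0 ≤ (2 * |c| + 2) ^ r * ((p : ℝ) / Real.log p) * (∏ i, A i) * G := by positivity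
  set Ξ : ℚ := ζ * ∏ i, ξ i ^ b i with hΞ
  -- the trivial case `ord_p(1 − Ξ) ≤ 0`
  by_cases hv : padicValRat p (1 - Ξ) ≤ 0
  · have : (padicValRat p (1 - Ξ) : ℝ) * Real.log p ≤ 0 :=
      mul_nonpos_of_nonpos_of_nonneg (by exact_mod_cast hv) hlogp.le
    linarith
  have hv1 : 1 ≤ padicValRat p (1 - Ξ) := by push Not at hv; omega
  -- `Ξ` is a unit
  have hζ0 : ζ ≠ 0 := by rcases hζ with h | h <;> simp [h]
  have hζv : padicValRat p ζ = 0 := by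
    rcases hζ with h | h
    · rw [h, padicValRat.one]
    · rw [h, padicValRat.neg, padicValRat.one]
  have hprod0 : ∏ i, ξ i ^ b i ≠ 0 := Finset.prod_ne_zero_iff.mpr fun i _ => zpow_ne_zero _ (hξ i)
  have hΞ0 : Ξ ≠ 0 := mul_ne_zero hζ0 hprod0
  have hΞ1' : Ξ - 1 ≠ 0 := sub_ne_zero.mpr hΞ1
  have hvneg : padicValRat p (1 - Ξ) = padicValRat p (Ξ - 1) := by
    rw [show (1 : ℚ) - Ξ = -(Ξ - 1) by ring, padicValRat.neg]
  have hΞv : padicValRat p Ξ = 0 := by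
    by_contra hne
    have := padicValRat_sub_one_nonpos_of_ne_zero hΞ0 hΞ1' hne
    rw [hvneg] at hv1; omega
  -- the `p`-free parts `uᵢ = ξᵢ p^{−eᵢ}`
  set e : Fin r → ℤ := fun i => padicValRat p (ξ i) with hedef
  set u : Fin r → ℚ := fun i => ξ i / (p : ℚ) ^ e i with hudef
  have hp0 : (p : ℚ) ≠ 0 := by exact_mod_cast hp.ne_zero
  have hu0 : ∀ i, u i ≠ 0 := fun i => div_ne_zero (hξ i) (zpow_ne_zero _ hp0)
  have huval : ∀ i, padicValRat p (u i) = 0 := by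
    intro i
    simp only [hudef, hedef]
    rw [padicValRat.div (hξ i) (zpow_ne_zero _ hp0), padicValRat.zpow,
      padicValRat.self hp.one_lt, mul_one, sub_self]
  have hfac : ∀ i, ξ i ^ b i = (p : ℚ) ^ (e i * b i) * u i ^ b i := by
    intro i
    have hk : ξ i = (p : ℚ) ^ e i * u i := by
      simp only [hudef]
      rw [mul_div_assoc', mul_div_cancel_left₀ _ (zpow_ne_zero _ hp0)]
    conv_lhs => rw [hk]
    rw [mul_zpow, ← zpow_mul]
  have hprodeq : ∏ i, ξ i ^ b i = (p : ℚ) ^ (∑ i, e i * b i) * ∏ i, u i ^ b i := by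
    rw [← rat_prod_zpow_eq_zpow_sum _ hp0, ← Finset.prod_mul_distrib]
    exact Finset.prod_congr rfl fun i _ => hfac i
  have hU0 : ∏ i, u i ^ b i ≠ 0 := Finset.prod_ne_zero_iff.mpr fun i _ => zpow_ne_zero _ (hu0 i)
  have hvU : padicValRat p (∏ i, u i ^ b i) = 0 := by
    rw [padicValRat_finset_prod _ _ fun i _ => zpow_ne_zero _ (hu0 i)]
    exact Finset.sum_eq_zero fun i _ => by rw [padicValRat.zpow, huval i, mul_zero]
  have hS : ∑ i, e i * b i = 0 := by
    by_contra hS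
    have hval : padicValRat p Ξ = ∑ i, e i * b i := by
      rw [hΞ, padicValRat.mul hζ0 hprod0, hζv, hprodeq, padicValRat.mul (zpow_ne_zero _ hp0) hU0,
        padicValRat.zpow, padicValRat.self hp.one_lt, hvU, mul_one, add_zero, zero_add]
    exact hS (by rw [← hval, hΞv])
  have hprodu : ∏ i, ξ i ^ b i = ∏ i, u i ^ b i := by rw [hprodeq, hS, zpow_zero, one_mul]
  set Ξ' : ℚ := ∏ i, u i ^ b i with hΞ'
  have hΞeq : Ξ = ζ * Ξ' := by rw [hΞ, hprodu]
  have hΞ'v : padicValRat p Ξ' = 0 := hvU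
  have hhu : ∀ i, logHeight₁ (u i) ≤ A i := fun i =>
    (logHeight₁_div_zpow_padicValRat_le hp (hξ i)).trans (hAh i)
  have huu : ∀ i, u i ≠ 0 ∧ padicValRat p (u i) = 0 := fun i => ⟨hu0 i, huval i⟩
  -- constants
  have hcr : c ^ r ≤ |c| ^ r := by rw [← abs_pow]; exact le_abs_self _
  have hpow1 : |c| ^ r ≤ (2 * |c| + 2) ^ r :=
    pow_le_pow_left₀ (abs_nonneg c) (by linarith [abs_nonneg c]) r
  have hXpos : 0 ≤ ((p : ℝ) / Real.log p) * (∏ i, A i) * G := by positivity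
  rcases hζ with hζ1 | hζ1
  · -- `ζ = 1`: the core for the units `uᵢ`
    have hΞ'1 : Ξ' ≠ 1 := by rw [hΞeq, hζ1, one_mul] at hΞ1; exact hΞ1
    have hcore := hc p hp hp2 r u b A Amax W huu hhu hA1 hAm hbW hW1 hΞ'1
    have h1 : padicValRat p (1 - Ξ) = padicValRat p (Ξ' - 1) := by
      rw [hvneg, hΞeq, hζ1, one_mul]
    rw [h1]
    have h2 : c ^ r * ((p : ℝ) / Real.log p) * (∏ i, A i) * G ≤
        (2 * |c| + 2) ^ r * ((p : ℝ) / Real.log p) * (∏ i, A i) * G := by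
      have := mul_le_mul_of_nonneg_right (hcr.trans hpow1) hXpos
      linarith [this]
    exact hcore.trans (by rw [hG] at h2; exact h2)
  · -- `ζ = −1`: `ord_p(1 + Ξ') ≤ ord_p(Ξ'² − 1)` and the core with doubled exponents
    have hΞm : Ξ = -Ξ' := by rw [hΞeq, hζ1]; ring
    have hΞ'p1 : Ξ' + 1 ≠ 0 := by
      intro h0; apply hΞ1
      have : Ξ' = -1 := eq_neg_of_add_eq_zero_left h0
      rw [hΞm, this]; norm_num
    have hΞ'm1 : Ξ' - 1 ≠ 0 := by
      intro h0
      have h1 : Ξ' = 1 := sub_eq_zero.mp h0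
      have h2 : (1 : ℚ) - Ξ = 2 := by rw [hΞm, h1]; norm_num
      have h3 : padicValRat p (1 - Ξ) = 0 := by
        rw [h2, show (2 : ℚ) = ((2 : ℕ) : ℚ) by norm_num, padicValRat.of_nat]
        exact_mod_cast padicValNat_primes hp2
      omega
    have hr : r ≠ 0 := by
      rintro rfl
      exact hΞ'm1 (by rw [hΞ']; simp)
    have htrans : padicValRat p (1 - Ξ) ≤ padicValRat p (Ξ' ^ 2 - 1) := by
      rw [hΞm, show (1 : ℚ) - -Ξ' = Ξ' + 1 by ring]
      exact padicValRat_add_one_le_sq_sub_one hΞ'v hΞ'm1 hΞ'p1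
    have hsq : Ξ' ^ 2 = ∏ i, u i ^ (2 * b i) := by
      rw [hΞ', ← Finset.prod_pow]
      refine Finset.prod_congr rfl fun i _ => ?_
      rw [← zpow_natCast, ← zpow_mul]; norm_num [mul_comm]
    have hsq1 : ∏ i, u i ^ (2 * b i) ≠ 1 := by
      rw [← hsq]
      intro h1
      exact mul_ne_zero hΞ'm1 hΞ'p1 (by rw [show (Ξ' - 1) * (Ξ' + 1) = Ξ' ^ 2 - 1 by ring, h1]; ring)
    -- the doubled exponents: `log max(3, 2|bᵢ|) ≤ W + log 2`
    have hl2 : Real.log 2 ≤ 1 := by have := Real.log_two_lt_d9; linarith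
    have hbW2 : ∀ i, Real.log (max 3 |((2 * b i : ℤ) : ℝ)|) ≤ W + Real.log 2 := by
      intro i
      have h0 : 0 < max 3 |(b i : ℝ)| := lt_of_lt_of_le (by norm_num) (le_max_left _ _)
      have h1 : max 3 |((2 * b i : ℤ) : ℝ)| ≤ 2 * max 3 |(b i : ℝ)| := by
        push_cast
        rw [abs_mul, abs_two]
        exact max_le (by linarith [le_max_left 3 |(b i : ℝ)|])
          (by linarith [le_max_right 3 |(b i : ℝ)|])
      have h2 : 0 < max 3 |((2 * b i : ℤ) : ℝ)| := lt_of_lt_of_le (by norm_num) (le_max_left _ _)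
      calc Real.log (max 3 |((2 * b i : ℤ) : ℝ)|) ≤ Real.log (2 * max 3 |(b i : ℝ)|) :=
            Real.log_le_log h2 h1
        _ = Real.log 2 + Real.log (max 3 |(b i : ℝ)|) := Real.log_mul two_ne_zero h0.ne'
        _ ≤ W + Real.log 2 := by linarith [hbW i]
    have hW2 : 1 ≤ W + Real.log 2 := by linarith [Real.log_nonneg one_le_two]
    have hcore := hc p hp hp2 r u (fun i => 2 * b i) A Amax (W + Real.log 2) huu hhu hA1 hAm hbW2 hW2
      hsq1
    rw [← hsq] at hcore
    have h1 : (padicValRat p (1 - Ξ) : ℝ) * Real.log p ≤ (padicValRat p (Ξ' ^ 2 - 1) : ℝ) * Real.log p :=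
      mul_le_mul_of_nonneg_right (by exact_mod_cast htrans) hlogp.le
    -- `c^r X (W + log 2 + log p + L) ≤ |c|^r X · 2G ≤ (2|c|+2)^r X G`
    have hX0 : 0 ≤ ((p : ℝ) / Real.log p) * (∏ i, A i) := by positivity
    have h2 : c ^ r * ((p : ℝ) / Real.log p) * (∏ i, A i) * (W + Real.log 2 + Real.log p +
        Real.log (2 * Amax)) ≤ |c| ^ r * ((p : ℝ) / Real.log p) * (∏ i, A i) * (2 * G) := by
      have h3 : W + Real.log 2 + Real.log p + Real.log (2 * Amax) ≤ 2 * G := by rw [hG]; linarith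
      have h4 : 0 ≤ W + Real.log 2 + Real.log p + Real.log (2 * Amax) := by linarith
      calc c ^ r * ((p : ℝ) / Real.log p) * (∏ i, A i) * (W + Real.log 2 + Real.log p +
            Real.log (2 * Amax))
          ≤ |c| ^ r * ((p : ℝ) / Real.log p) * (∏ i, A i) * (W + Real.log 2 + Real.log p +
            Real.log (2 * Amax)) := by
            apply mul_le_mul_of_nonneg_right _ h4
            have := mul_le_mul_of_nonneg_right hcr hX0; linarith [this]
        _ ≤ |c| ^ r * ((p : ℝ) / Real.log p) * (∏ i, A i) * (2 * G) :=
            mul_le_mul_of_nonneg_left h3 (by positivity)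
    have h5 : 2 * |c| ^ r ≤ (2 * |c| + 2) ^ r := by
      have h6 : (2 * |c|) ^ r + 2 ^ r ≤ (2 * |c| + 2) ^ r :=
        pow_add_pow_le (by positivity) zero_le_two hr
      have h7 : (2 : ℝ) ≤ 2 ^ r := by
        calc (2 : ℝ) = 2 ^ 1 := (pow_one _).symm
          _ ≤ 2 ^ r := pow_le_pow_right₀ one_le_two (Nat.one_le_iff_ne_zero.mpr hr)
      have h8 : 2 * |c| ^ r ≤ (2 * |c|) ^ r := by
        rw [mul_pow]; exact mul_le_mul_of_nonneg_right h7 (pow_nonneg (abs_nonneg c) r)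
      linarith [pow_nonneg (zero_le_two (α := ℝ)) r]
    have h9 : |c| ^ r * ((p : ℝ) / Real.log p) * (∏ i, A i) * (2 * G) ≤
        (2 * |c| + 2) ^ r * ((p : ℝ) / Real.log p) * (∏ i, A i) * G := by
      have := mul_le_mul_of_nonneg_right h5 hXpos
      linarith [this]
    rw [hG] at h9
    linarith [h1, hcore, h2, h9]

/-- **Composite: from the planner's `PadicCoreOddRat` text to `ord_p(1 − ζ∏ξᵢ^{bᵢ})`** for non-zero
rationals `ξᵢ` and `ζ = ±1` (`padicShape_dep_of_indep_odd`, then `padicShape_oneSub_of_dep_odd`).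
[cite: EvertseGyory2015, §4.4 (pp. 80–81)] -/
theorem padicShape_oneSub_of_indep_odd
    (h : ∃ c : ℝ, ∀ (p : ℕ), p.Prime → p ≠ 2 →
      ∀ (r : ℕ) (θ : Fin r → ℚ) (m : Fin r → ℤ) (A : Fin r → ℝ) (Amax W : ℝ),
        (∀ i, θ i ≠ 0 ∧ padicValRat p (θ i) = 0) →
        (∀ μ : Fin r → ℤ, ∏ i, θ i ^ μ i = 1 → μ = 0) →
        (∀ i, Height.logHeight₁ (θ i) ≤ A i) → (∀ i, 1 ≤ A i) → (∀ i, A i ≤ Amax) →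
        m ≠ 0 → (∀ i, Real.log (max 3 (|m i| : ℝ)) ≤ W) → 1 ≤ W →
        (padicValRat p (∏ i, θ i ^ m i - 1) : ℝ) * Real.log p ≤
          c ^ r * ((p : ℝ) / Real.log p) * (∏ i, A i) * (W + Real.log p + Real.log (2 * Amax))) :
    ∃ c : ℝ, ∀ (p : ℕ), p.Prime → p ≠ 2 →
      ∀ (r : ℕ) (ξ : Fin r → ℚ) (b : Fin r → ℤ) (A : Fin r → ℝ) (Amax W : ℝ) (ζ : ℚ),
        (ζ = 1 ∨ ζ = -1) → (∀ i, ξ i ≠ 0) →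
        (∀ i, Height.logHeight₁ (ξ i) ≤ A i) → (∀ i, 1 ≤ A i) → (∀ i, A i ≤ Amax) → 1 ≤ Amax →
        (∀ i, Real.log (max 3 (|b i| : ℝ)) ≤ W) → 1 ≤ W → ζ * ∏ i, ξ i ^ b i ≠ 1 →
        (padicValRat p (1 - ζ * ∏ i, ξ i ^ b i) : ℝ) * Real.log p ≤
          c ^ r * ((p : ℝ) / Real.log p) * (∏ i, A i) * (W + Real.log p + Real.log (2 * Amax)) :=
  padicShape_oneSub_of_dep_odd (padicShape_dep_of_indep_odd h)

end Summit.ABC.StewartYu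

end
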